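import Literature.MathematicalPhysics.QuantumFieldTheory.Balaban1983to89.Node00.Record12
import HarnessLib

/-!
# BalabanLadder ∕ UV — Track A's output ONE LINE BEFORE the Stage-0 projection, as two named packages at NODE 00's Stage-12 record

OS-ASSEMBLY BOOKKEEPING (cell `ym-fleet`, seat `ym-osasm-p1`, director-ym R136 (iii); `--supports stmt-QuantumFields-19351` = the spine crux
`Summit.QuantumFields.YangMills.Theses.BalabanLadder.UV`, binder `hUV` of `BalabanLadder.closes`).  DEFINITIONS ONLY (two `Prop`s, parametric in the
group rank `N`); nothing of Bałaban's is asserted; COUNT-NEUTRAL.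

WHY.  Since rev 13–15 of the detail route `route-QuantumFields-BalabanUVNodes` (2026-08-26) its deciding theorem
`BalabanUVNodes.closes (h0 : Record12Inhabited) (h1 : StabilityBAtRecordR12e) (h2 : EndpointGivenBR12) (h3 : SpineGivenEndpointR12) : BalabanLadder.UV`
is θ-KEYED at NODE 00's Stage-12 record: K1′ yields an admissible Stage-12 parameter tuple `θ` with its displayed provisos `h`, print's partition
of unity and non-degenerate slots, (B) as printed at the datum of record `Node00.datumOfRecord₁₂ F 2 θ h` and the `K ≥ 1` coupling window; K2′ and K3′
add endpoint existence and the hybrid-NE7 spine AT THAT RECORD; only then does `closes` forget `θ` and project to the Stage-0 leaf `UV`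
(`Node00.isDatumOfRecord₀_datumOfRecord₁₂`, `rfl`).  Every consumer that needs the PINNED record rather than a Stage-0 datum — the E1 restate of `UV`
«over Node00» (R85 item 1, definer window 08-30…09-01), E0′ = `UVSeamRec.stub_ceilings` (densities ⇒ expectations ON THE SAME TORUS needs
`D = datumOfRecord₁₂ θ h`, owner ruling `RULING-parity-S0-g21` R5), the infinite-volume programme's `UVCond` — wants exactly the conjunction `closes`
holds one line before the projection.  This file NAMES it, once, in the two currencies in use:

* `UVAtParams12 N` — θ-keyed (the route's rev-15 currency): `∀ F, ∃ θ h, (ZtUnity ∧ SlotsNondegenerate) ∧ Admissible ∧ (B) ∧ window(K ≥ 1) ∧ END ∧ NE7`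
  at `Node00.datumOfRecord₁₂ F N θ h`;
* `UVAtRecord12C N` — (D, w)-keyed (def-T's ∕ `Theorems.UVOtherGroups.uvD59_of_recordChain₁₂C`'s currency): `∀ F, ∃ D w, Node00.IsRecordOfRecord₁₂C F N D w ∧
  (B) ∧ window(K ≥ 1) ∧ END ∧ NE7`.

The kernels (`Theorems/BalabanLadderUVRecord12.lean`) prove: the four rev-15 texts (with `2 ↦ N`, INLINE) ⇒ `UVAtParams12 N`; `UVAtParams12 N ⇒
UVAtRecord12C N` (`Node00.exists_world_isRecordOfRecord₁₂C`); both ⇒ the Stage-0 text (= the body of `YMDAG.UVSplit.UVD59 N`, at `N = 2` the body of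
`BalabanLadder.UV`: consumers close those goals by `exact`, definitional unfolding); the T⁴ apex and its law-reading AT the pinned record.  ROUTE-INDEPENDENT
BY DESIGN (standing build rule 2026-08-26T18:55Z): neither module imports a `Theses` file or a module in a route's cone, so no route edit (Track A's
restates of K0′–K3′, the spine's R85 restate of `UV`) can break them; the by-name junctions (items ⇒ package ⇒ `UV` ∕ `UVD59 N`, `= BalabanUVNodes.closes` by
`rfl`) are certified in a desk scratch attached as evidence on stmt-QuantumFields-19351 and become a one-line tree adapter the hour the E1 text of `UV`
lands.  HONEST FRAMING: names for HYPOTHESES of a conditional chain (0∕6 spine legs discharged); one finite four-torus programme per family at fixed ε;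
NOT infinite volume, NOT OS on ℝ⁴, NOT a mass gap, NOT Clay.
-/

set_option autoImplicit false

namespace Summit.QuantumFields.YangMills.Cruxes.UV.Record12

open Literature.MathematicalPhysics.QuantumFieldTheory.Balaban1983to89
open Literature.MathematicalPhysics.QuantumFieldTheory.Balaban1983to89.T4Continuum

/-- **TRACK A's UV PACKAGE AT THE PINNED STAGE-12 RECORD, θ-KEYED** (`SU(N)`; the spine's is `N = 2`): on every four-torus family some admissible
Stage-12 parameter tuple `θ` satisfying its displayed provisos `h`, with print's partition of unity and non-degenerate present slots, whose datum
of record `Node00.datumOfRecord₁₂ F N θ h` carries [III]'s end statement (B) as printed, the non-vacuity coupling window with `K ≥ 1`, endpoint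
existence of its coupling flow ([I] Thm 2, endpoint half) and the hybrid-NE7 spine under it.  Verbatim the conjunction the detail route's rev-15
`closes` holds after feeding K1′'s record to K2′ and K3′ and before projecting to Stage 0.  OPEN as a whole; never asserted. -/
def UVAtParams12 (N : ℕ) [NeZero N] : Prop :=
  ∀ F : T4Family, ∃ (θ : Node00.Stage12Params F N) (h : θ.Provisos₁₂ F N),
    (θ.ZtUnity F N ∧ θ.SlotsNondegenerate) ∧ θ.Admissible F N ∧
    B16.EndStatementBPrinted (Node00.datumOfRecord₁₂ F N θ h).C ∧
    (∃ γ₁ : ℝ, 0 < γ₁ ∧ ∀ γ : ℝ, 0 < γ → γ ≤ γ₁ →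
      ∃ P : B12.RunParams, 1 ≤ P.K ∧ ((Node00.datumOfRecord₁₂ F N θ h).C P).flow.InInterval γ P.K) ∧
    DagBinding.EndpointExistence (Node00.datumOfRecord₁₂ F N θ h).C.toB12 ∧
    T4ApexHybrid.HybridNE7Under (Node00.datumOfRecord₁₂ F N θ h)
      (DagBinding.EndpointExistence (Node00.datumOfRecord₁₂ F N θ h).C.toB12)

/-- **TRACK A's UV PACKAGE AT A STAGE-12 RECORD-OF-RECORD, (D, w)-KEYED** (`SU(N)`): on every four-torus family some finite-ε datum `D` and world
`w` with `Node00.IsRecordOfRecord₁₂C F N D w` («(D, w) is the record, Stage 12»: `D = datumOfRecord₁₂ θ h` for admissible θ with provisos, `w` bound to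
its construction), carrying (B) as printed, the `K ≥ 1` coupling window, endpoint existence and the hybrid-NE7 spine.  The currency of
`Theorems.UVOtherGroups.uvD59_of_recordChain₁₂C`; implied by `UVAtParams12 N` (the unity ∕ non-degeneracy clause is dropped — the record predicate
does not carry it).  OPEN as a whole; never asserted. -/
def UVAtRecord12C (N : ℕ) [NeZero N] : Prop :=
  ∀ F : T4Family, ∃ (D : FiniteEpsData F (Matrix.specialUnitaryGroup (Fin N) ℂ)) (w : DagBinding.WorldP),
    Node00.IsRecordOfRecord₁₂C F N D w ∧ B16.EndStatementBPrinted D.C ∧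
    (∃ γ₁ : ℝ, 0 < γ₁ ∧ ∀ γ : ℝ, 0 < γ → γ ≤ γ₁ → ∃ P : B12.RunParams, 1 ≤ P.K ∧ (D.C P).flow.InInterval γ P.K) ∧
    DagBinding.EndpointExistence D.C.toB12 ∧
    T4ApexHybrid.HybridNE7Under D (DagBinding.EndpointExistence D.C.toB12)

end Summit.QuantumFields.YangMills.Cruxes.UV.Record12
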